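import Literature.GroupTheory.CombinatorialGroupTheory.ReidemeisterSchreier
import Mathlib.GroupTheory.SemidirectProduct
import Mathlib.GroupTheory.GroupAction.Quotient
import HarnessLib

/-!
# Reidemeister–Schreier by coverings: the presentation of a subgroup on the lifted generators

Topic `Literature/GroupTheory/CombinatorialGroupTheory`; continues `ReidemeisterSchreier.lean`.
Let `G = ⟨X ∣ rels⟩`, `K ≤ G`, and let `F = F(X)` act on the coset set `A = G ⧸ K` (or, more
generally, on any set `A`, through a homomorphism `act : F(X) → Sym(A)` under which the relators
act trivially, with a base point `a₀` whose stabiliser is `K̃`).  The covering of the presentation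
complex belonging to `K` has vertex set `A`, one edge `(x, a) : a ⟶ x·a` for each generator `x`
and vertex `a` (`Edge X A = X × A`), and one 2-cell for each relator `r` and vertex: its boundary
is the LIFT of `r`, the word in the edges read off along the path of `r`.  Choosing a spanning
tree (here: a transversal `t : A → F(X)` whose words are tree paths, `SchreierTree`), the
fundamental group of the covering is

  `K ≅ ⟨ X × A ∣ lifted relators `pathWord r a` (r ∈ rels, a ∈ A), tree edges ⟩`

(Reidemeister 1932 / Schreier 1927 in the form of Zieschang–Vogt–Coldewey, LNM 835, 2.2.1–2.2.4
and §4.14 proof of 4.14.1: "the generators of the subgroup are the `t x t̄⁻¹`, the relations the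
`t r t⁻¹` rewritten"; Lyndon–Schupp II.4.1).  Differences to `ReidemeisterSchreier.lean`: no free
basis of `K̃` is needed (the tree edges are kept as generators and killed), and the relators are
EXPLICIT WORDS in the edges, which is what the Euler-characteristic / surface arguments of §4.14
(finite-index subgroups of surface groups) consume.

Construction (all proved, no named facts):
* `precompAut`, `arrowAut` — `F(X)` acts on `A → M` by `(f·n)(b) = n(f⁻¹ b)`;
* `theta : F(X) →* (A → F(X × A)) ⋊ F(X)` — the cocycle; `pathWord f b = (theta f).left b` is the
  edge word of the path of `f` ENDING at `b`; `pathWord_mul/one/inv/of` (cocycle identities);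
* `SchreierTree act a₀` — transversal `t` with `t a₀ = 1`, `t a · a₀ = a`, a set of tree edges
  with `t (x·a) = x · t a` on tree edges and every `pathWord (t a) a` a product of tree edges;
* `liftedRels` — the relator set above; `gammaHom` — `(x, a) ↦ t(x·a)⁻¹ · x · t(a)`;
  `gammaHom_pathWord : gammaHom (pathWord f b) = t(b)⁻¹ · f · t(f⁻¹ b)` (telescoping);
* `stabilizerQuotientEquiv` — `K̃ ⧸ N ≃* ⟨X × A ∣ liftedRels⟩` (`N` = normal closure of `rels`);
* `subgroupEquivCoveringPresentation` — for `K ≤ ⟨X ∣ rels⟩` and a Schreier tree of the coset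
  action: `K ≃* ⟨X × (G ⧸ K) ∣ liftedRels⟩`.

## References

* H. Zieschang, E. Vogt, H.-D. Coldewey, *Surfaces and Planar Discontinuous Groups*, LNM 835,
  Springer 1980, 2.2.1–2.2.4, 4.14.1. [ZieschangVogtColdewey1980]
* R. C. Lyndon, P. E. Schupp, *Combinatorial Group Theory*, II Prop. 4.1. [LyndonSchupp2001]
-/

namespace Literature.GroupTheory.CombinatorialGroupTheory

open SemidirectProduct

namespace CoveringPresentation

universe u v

variable {X : Type u} {A : Type v}

/-! ### The action of `F(X)` on edge-valued functions and the cocycle -/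

/-- Precomposition with the inverse of a permutation, as a multiplicative automorphism of
`A → M`: `(precompAut σ n) b = n (σ⁻¹ b)`. [cite: ZieschangVogtColdewey1980, 2.2.1] -/
def precompAut {M : Type*} [Monoid M] (σ : Equiv.Perm A) : MulAut (A → M) where
  toFun n := n ∘ σ.symm
  invFun n := n ∘ σ
  left_inv n := by ext b; simp
  right_inv n := by ext b; simp
  map_mul' _ _ := rfl

/-- `precompAut σ n b = n (σ.symm b)`. [cite: ZieschangVogtColdewey1980, 2.2.1] -/
@[simp] theorem precompAut_apply {M : Type*} [Monoid M] (σ : Equiv.Perm A) (n : A → M) (b : A) :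
    precompAut σ n b = n (σ.symm b) := rfl

/-- The action `f ↦ precompAut (act f)` of `F(X)` on `A → M` through `act : F(X) → Sym(A)`.
[cite: ZieschangVogtColdewey1980, 2.2.1] -/
def arrowAut {M : Type*} [Monoid M] (act : FreeGroup X →* Equiv.Perm A) :
    FreeGroup X →* MulAut (A → M) where
  toFun f := precompAut (act f)
  map_one' := by
    ext n b
    change n ((act 1).symm b) = n b
    rw [map_one]; rfl
  map_mul' f g := by ext n b; simp [Equiv.Perm.mul_def]

/-- `arrowAut act f n b = n (act f⁻¹ b)`. [cite: ZieschangVogtColdewey1980, 2.2.1] -/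
@[simp] theorem arrowAut_apply {M : Type*} [Monoid M] (act : FreeGroup X →* Equiv.Perm A)
    (f : FreeGroup X) (n : A → M) (b : A) : arrowAut act f n b = n (act f⁻¹ b) := by
  simp [arrowAut, map_inv]

/-- `σ (σ⁻¹ b) = b` for a permutation. [folklore] -/
private theorem perm_apply_inv_self (σ : Equiv.Perm A) (b : A) : σ (σ⁻¹ b) = b :=
  σ.apply_symm_apply b

/-- `σ⁻¹ (σ b) = b` for a permutation. [folklore] -/
private theorem perm_inv_apply_self (σ : Equiv.Perm A) (b : A) : σ⁻¹ (σ b) = b :=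
  σ.symm_apply_apply b

variable (act : FreeGroup X →* Equiv.Perm A)

/-- **The cocycle** `θ : F(X) → (A → F(X × A)) ⋊ F(X)`: the generator `x` goes to
(`b ↦` the edge `(x, x⁻¹ b)` ending at `b`, `x`). [cite: ZieschangVogtColdewey1980, 2.2.2] -/
def theta : FreeGroup X →* (A → FreeGroup (X × A)) ⋊[arrowAut act] FreeGroup X :=
  FreeGroup.lift fun x => ⟨fun b => FreeGroup.of (x, act (FreeGroup.of x)⁻¹ b), FreeGroup.of x⟩

/-- The `F(X)`-component of the cocycle is the identity. [cite: ZieschangVogtColdewey1980, 2.2.2] -/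
@[simp] theorem theta_right (f : FreeGroup X) : (theta act f).right = f := by
  have h : (rightHom.comp (theta act)) = MonoidHom.id _ :=
    FreeGroup.ext_hom _ _ fun x => by simp [theta]
  exact DFunLike.congr_fun h f

/-- **The edge word of the path of `f` ending at the vertex `b`** (starting at `f⁻¹ b`).
[cite: ZieschangVogtColdewey1980, 2.2.2] -/
def pathWord (f : FreeGroup X) (b : A) : FreeGroup (X × A) := (theta act f).left b

/-- Cocycle identity: the path of `f g` ending at `b` is the path of `g` ending at `f⁻¹ b`
followed by the path of `f` ending at `b`. [cite: ZieschangVogtColdewey1980, 2.2.2] -/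
theorem pathWord_mul (f g : FreeGroup X) (b : A) :
    pathWord act (f * g) b = pathWord act f b * pathWord act g (act f⁻¹ b) := by
  simp [pathWord, map_mul, mul_left]

/-- The empty path. [cite: ZieschangVogtColdewey1980, 2.2.2] -/
@[simp] theorem pathWord_one (b : A) : pathWord act 1 b = 1 := by
  simp [pathWord]

/-- The path of a generator `x` ending at `b` is the edge `(x, x⁻¹ b)`.
[cite: ZieschangVogtColdewey1980, 2.2.2] -/
@[simp] theorem pathWord_of (x : X) (b : A) :
    pathWord act (FreeGroup.of x) b = FreeGroup.of (x, act (FreeGroup.of x)⁻¹ b) := by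
  simp [pathWord, theta]

/-- The path of `f⁻¹` is the reversed path of `f`. [cite: ZieschangVogtColdewey1980, 2.2.2] -/
theorem pathWord_inv (f : FreeGroup X) (b : A) :
    pathWord act f⁻¹ b = (pathWord act f (act f b))⁻¹ := by
  have h := pathWord_mul act f f⁻¹ (act f b)
  rw [mul_inv_cancel, pathWord_one, map_inv, ← Equiv.Perm.mul_apply, inv_mul_cancel,
    Equiv.Perm.one_apply] at h
  exact eq_inv_of_mul_eq_one_right h.symm

/-- Double cocycle identity. [cite: ZieschangVogtColdewey1980, 2.2.2] -/
theorem pathWord_mul_mul (f g h : FreeGroup X) (b : A) :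
    pathWord act (f * g * h) b =
      pathWord act f b * pathWord act g (act f⁻¹ b) * pathWord act h (act g⁻¹ (act f⁻¹ b)) := by
  rw [pathWord_mul, pathWord_mul, mul_inv_rev, map_mul, Equiv.Perm.mul_apply, mul_assoc]

/-- Conjugating a word acting trivially conjugates its paths.
[cite: ZieschangVogtColdewey1980, 2.2.2] -/
theorem pathWord_conj {f : FreeGroup X} (hf : act f = 1) (g : FreeGroup X) (b : A) :
    pathWord act (g * f * g⁻¹) b = pathWord act g b * pathWord act f (act g⁻¹ b) * (pathWord act g b)⁻¹ := by
  rw [pathWord_mul_mul, pathWord_inv, map_inv act f, hf, inv_one, Equiv.Perm.one_apply, map_inv act g,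
    perm_apply_inv_self]

/-! ### Schreier trees and the lifted presentation -/

/-- **A Schreier tree** for the action at the base point `a₀`: a transversal `t` (`t a` carries
`a₀` to `a`, `t a₀ = 1`) and a set of tree edges such that `t (x·a) = x · t a` for every tree
edge `(x, a)` and every `t a` runs along tree edges (its path word is a product of tree edges).
(ZVC 2.2.2: "Schreier condition: every initial segment of a representative is a representative".)
[cite: ZieschangVogtColdewey1980, 2.2.2] -/
structure SchreierTree (act : FreeGroup X →* Equiv.Perm A) (a₀ : A) where
  /-- the transversal `t : A → F(X)` -/
  t : A → FreeGroup X
  /-- the representative of the base point is trivial -/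
  t_root : t a₀ = 1
  /-- `t a` carries the base point to `a` -/
  t_apply : ∀ a, act (t a) a₀ = a
  /-- the tree edges -/
  edges : Set (X × A)
  /-- along a tree edge the representatives differ by the generator -/
  t_edge : ∀ e ∈ edges, t (act (FreeGroup.of e.1) e.2) = FreeGroup.of e.1 * t e.2
  /-- every representative runs along tree edges -/
  pathWord_t_mem : ∀ a, pathWord act (t a) a ∈ Subgroup.closure (FreeGroup.of '' edges)

/-- **The relators of the covering presentation**: all lifts `pathWord r b` of the relators
`r ∈ rels` (one for each end vertex `b`), and the tree edges. [cite: ZieschangVogtColdewey1980, 2.2.4] -/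
def liftedRels (rels : Set (FreeGroup X)) (T : Set (X × A)) : Set (FreeGroup (X × A)) :=
  {w | ∃ r ∈ rels, ∃ b : A, w = pathWord act r b} ∪ FreeGroup.of '' T

variable {act} {a₀ : A} (𝒯 : SchreierTree act a₀)

/-- The inverse of a representative brings its vertex back to the base point.
[cite: ZieschangVogtColdewey1980, 2.2.2] -/
theorem SchreierTree.act_inv_t (a : A) : act (𝒯.t a)⁻¹ a = a₀ := by
  rw [map_inv, Equiv.Perm.inv_eq_iff_eq, 𝒯.t_apply]

/-- **The Schreier generator of an edge**: `γ(x, a) = t(x·a)⁻¹ · x · t(a)` (an element of the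
stabiliser of `a₀`). [cite: ZieschangVogtColdewey1980, 2.2.2] -/
def gammaHom : FreeGroup (X × A) →* FreeGroup X :=
  FreeGroup.lift fun e => (𝒯.t (act (FreeGroup.of e.1) e.2))⁻¹ * FreeGroup.of e.1 * 𝒯.t e.2

/-- `γ` on an edge. [cite: ZieschangVogtColdewey1980, 2.2.2] -/
@[simp] theorem gammaHom_of (e : X × A) :
    gammaHom 𝒯 (FreeGroup.of e) = (𝒯.t (act (FreeGroup.of e.1) e.2))⁻¹ * FreeGroup.of e.1 * 𝒯.t e.2 :=
  FreeGroup.lift_apply_of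

/-- **Telescoping**: `γ` of the path word of `f` ending at `b` is `t(b)⁻¹ · f · t(f⁻¹ b)`
(ZVC 2.2.3: "`t x t̄⁻¹ ⋯` rewriting"). [cite: ZieschangVogtColdewey1980, 2.2.3] -/
theorem gammaHom_pathWord (f : FreeGroup X) :
    ∀ b : A, gammaHom 𝒯 (pathWord act f b) = (𝒯.t b)⁻¹ * f * 𝒯.t (act f⁻¹ b) := by
  induction f using FreeGroup.induction_on with
  | C1 => intro b; simp
  | of x =>
    intro b
    rw [pathWord_of, gammaHom_of]
    dsimp only
    rw [map_inv, perm_apply_inv_self]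
  | inv_of x ih =>
    intro b
    rw [pathWord_inv, map_inv (gammaHom 𝒯), ih, inv_inv, map_inv act, perm_inv_apply_self]
    simp only [mul_inv_rev, inv_inv, mul_assoc]
  | mul f g ihf ihg =>
    intro b
    rw [pathWord_mul, map_mul, ihf, ihg, mul_inv_rev, map_mul, Equiv.Perm.mul_apply]
    simp only [mul_assoc, mul_inv_cancel_left]

section Main

variable {rels : Set (FreeGroup X)} (hrels : ∀ r ∈ rels, act r = 1)
  (S : Subgroup (FreeGroup X)) (hS : ∀ f, f ∈ S ↔ act f a₀ = a₀)

/-- The words acting trivially all of whose path words are consequences of the lifted relators: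
a normal subgroup containing the relators. [cite: ZieschangVogtColdewey1980, 2.2.4] -/
def trivialPathSubgroup : Subgroup (FreeGroup X) where
  carrier := {f | act f = 1 ∧
    ∀ b, pathWord act f b ∈ Subgroup.normalClosure (liftedRels act rels 𝒯.edges)}
  mul_mem' := by
    rintro f g ⟨hf, hf'⟩ ⟨hg, hg'⟩
    refine ⟨by rw [map_mul, hf, hg, one_mul], fun b => ?_⟩
    rw [pathWord_mul]
    exact mul_mem (hf' b) (hg' _)
  one_mem' := ⟨map_one act, fun b => by rw [pathWord_one]; exact one_mem _⟩
  inv_mem' := by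
    rintro f ⟨hf, hf'⟩
    refine ⟨by rw [map_inv, hf, inv_one], fun b => ?_⟩
    rw [pathWord_inv]
    exact inv_mem (hf' _)

/-- `trivialPathSubgroup` is normal. [cite: ZieschangVogtColdewey1980, 2.2.4] -/
theorem trivialPathSubgroup_normal : (trivialPathSubgroup (rels := rels) 𝒯).Normal := by
  refine ⟨fun f hf g => ?_⟩
  obtain ⟨hf, hf'⟩ := hf
  refine ⟨by rw [map_mul, map_mul, hf, mul_one, ← map_mul, mul_inv_cancel, map_one], fun b => ?_⟩
  rw [pathWord_conj act hf]
  exact (Subgroup.normalClosure_normal).conj_mem _ (hf' _) _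

include hrels in
/-- The normal closure of the relators acts trivially with path words that are consequences of
the lifted relators. [cite: ZieschangVogtColdewey1980, 2.2.4] -/
theorem normalClosure_le_trivialPathSubgroup :
    Subgroup.normalClosure rels ≤ trivialPathSubgroup (rels := rels) 𝒯 := by
  haveI := trivialPathSubgroup_normal (rels := rels) 𝒯
  refine Subgroup.normalClosure_le_normal fun r hr => ⟨hrels r hr, fun b => ?_⟩
  exact Subgroup.subset_normalClosure (Or.inl ⟨r, hr, b, rfl⟩)

/-- `γ` with values in the stabiliser `S` of `a₀`. [cite: ZieschangVogtColdewey1980, 2.2.2] -/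
def gammaStab : FreeGroup (X × A) →* S :=
  FreeGroup.lift fun e => ⟨(𝒯.t (act (FreeGroup.of e.1) e.2))⁻¹ * FreeGroup.of e.1 * 𝒯.t e.2, by
    rw [hS, map_mul, map_mul, Equiv.Perm.mul_apply, Equiv.Perm.mul_apply, 𝒯.t_apply,
      𝒯.act_inv_t]⟩

/-- `gammaStab` is `gammaHom` as an element of `F(X)`. [cite: ZieschangVogtColdewey1980, 2.2.2] -/
theorem coe_gammaStab (w : FreeGroup (X × A)) : ((gammaStab 𝒯 S hS w : S) : FreeGroup X) = gammaHom 𝒯 w := by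
  have h : S.subtype.comp (gammaStab 𝒯 S hS) = gammaHom 𝒯 :=
    FreeGroup.ext_hom _ _ fun e => by simp [gammaStab, gammaHom]
  exact DFunLike.congr_fun h w

/-- The normal closure `N` of the relators, viewed inside the stabiliser `S` (so that `S ⧸ N` makes
sense). [cite: ZieschangVogtColdewey1980, 2.2.4] -/
abbrev relN (rels : Set (FreeGroup X)) (S : Subgroup (FreeGroup X)) : Subgroup S :=
  (Subgroup.normalClosure rels).subgroupOf S

/-- `Φ : ⟨X × A ∣ liftedRels⟩ → S ⧸ N`, edge ↦ Schreier generator.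
[cite: ZieschangVogtColdewey1980, 2.2.4] -/
def phiHom : PresentedGroup (liftedRels act rels 𝒯.edges) →* S ⧸ (relN rels S) :=
  PresentedGroup.toGroup (f := fun e => QuotientGroup.mk' (relN rels S) (gammaStab 𝒯 S hS (FreeGroup.of e))) (by
    have hl : FreeGroup.lift (fun e => QuotientGroup.mk' (relN rels S) (gammaStab 𝒯 S hS (FreeGroup.of e))) =
        (QuotientGroup.mk' (relN rels S)).comp (gammaStab 𝒯 S hS) :=
      FreeGroup.ext_hom _ _ fun e => by simp
    intro w hw
    rw [hl, MonoidHom.comp_apply, QuotientGroup.mk'_apply, QuotientGroup.eq_one_iff,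
      Subgroup.mem_subgroupOf, coe_gammaStab]
    rcases hw with ⟨r, hr, b, rfl⟩ | ⟨e, he, rfl⟩
    · rw [gammaHom_pathWord, map_inv, hrels r hr, inv_one, Equiv.Perm.one_apply]
      simpa using (Subgroup.normalClosure_normal (s := rels)).conj_mem r
        (Subgroup.subset_normalClosure hr) (𝒯.t b)⁻¹
    · have hγ : gammaHom 𝒯 (FreeGroup.of e) = 1 := by
        rw [gammaHom_of, 𝒯.t_edge e he, mul_inv_rev, inv_mul_cancel_right, inv_mul_cancel]
      rw [hγ]
      exact (Subgroup.normalClosure rels).one_mem)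

/-- `Φ` on a generator. [cite: ZieschangVogtColdewey1980, 2.2.4] -/
theorem phiHom_of (e : X × A) :
    phiHom 𝒯 hrels S hS (PresentedGroup.of e) = QuotientGroup.mk' (relN rels S) (gammaStab 𝒯 S hS (FreeGroup.of e)) :=
  PresentedGroup.toGroup.of _

/-- `Φ ∘ mk = mk' ∘ γ`. [cite: ZieschangVogtColdewey1980, 2.2.4] -/
theorem phiHom_mk (w : FreeGroup (X × A)) :
    phiHom 𝒯 hrels S hS (PresentedGroup.mk _ w) = QuotientGroup.mk' (relN rels S) (gammaStab 𝒯 S hS w) := by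
  have h : (phiHom 𝒯 hrels S hS).comp (PresentedGroup.mk _) =
      (QuotientGroup.mk' (relN rels S)).comp (gammaStab 𝒯 S hS) :=
    FreeGroup.ext_hom _ _ fun e => by
      rw [MonoidHom.comp_apply, MonoidHom.comp_apply]
      exact phiHom_of 𝒯 hrels S hS e
  exact DFunLike.congr_fun h w

/-- `ψ : S → ⟨X × A ∣ liftedRels⟩`, `h ↦ [pathWord h a₀]` — a homomorphism on the stabiliser.
[cite: ZieschangVogtColdewey1980, 2.2.3] -/
def psiHom : S →* PresentedGroup (liftedRels act rels 𝒯.edges) :=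
  MonoidHom.mk' (fun h => PresentedGroup.mk _ (pathWord act (h : FreeGroup X) a₀)) fun h h' => by
    have hh : act (h : FreeGroup X)⁻¹ a₀ = a₀ := by
      rw [map_inv, Equiv.Perm.inv_eq_iff_eq]; exact ((hS h).1 h.2).symm
    simp only [Subgroup.coe_mul, pathWord_mul, hh, map_mul]

include hrels in
/-- `ψ` kills `N`. [cite: ZieschangVogtColdewey1980, 2.2.4] -/
theorem psiHom_ker : (relN rels S) ≤ (psiHom 𝒯 S hS (rels := rels)).ker := by
  intro h hh
  rw [Subgroup.mem_subgroupOf] at hh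
  rw [MonoidHom.mem_ker]
  change PresentedGroup.mk _ (pathWord act (h : FreeGroup X) a₀) = 1
  rw [PresentedGroup.mk_eq_one_iff]
  exact (normalClosure_le_trivialPathSubgroup 𝒯 hrels hh).2 a₀

/-- `Ψ : S ⧸ N → ⟨X × A ∣ liftedRels⟩`. [cite: ZieschangVogtColdewey1980, 2.2.4] -/
def psiLift : S ⧸ (relN rels S) →* PresentedGroup (liftedRels act rels 𝒯.edges) :=
  QuotientGroup.lift (relN rels S) (psiHom 𝒯 S hS) (psiHom_ker 𝒯 hrels S hS)

/-- The path word of a representative is trivial in the covering presentation.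
[cite: ZieschangVogtColdewey1980, 2.2.4] -/
theorem mk_pathWord_t (a : A) :
    PresentedGroup.mk (liftedRels act rels 𝒯.edges) (pathWord act (𝒯.t a) a) = 1 := by
  rw [PresentedGroup.mk_eq_one_iff]
  refine (Subgroup.closure_le _).2 ?_ (𝒯.pathWord_t_mem a)
  exact fun w hw => Subgroup.subset_normalClosure (Or.inr hw)

/-- **`K̃ ⧸ N ≃ ⟨X × A ∣ lifted relators, tree edges⟩`** (Reidemeister–Schreier by coverings):
for an action of `F(X)` on `A` in which the relators act trivially, the quotient of the stabiliser
`S` of the base point by the normal closure `N` of the relators is presented on the edges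
`X × A` by the lifted relators and the edges of a Schreier tree.
[cite: ZieschangVogtColdewey1980, 2.2.4] -/
noncomputable def stabilizerQuotientEquiv :
    S ⧸ (relN rels S) ≃* PresentedGroup (liftedRels act rels 𝒯.edges) :=
  MonoidHom.toMulEquiv (psiLift 𝒯 hrels S hS) (phiHom 𝒯 hrels S hS)
    (by
      refine QuotientGroup.monoidHom_ext (relN rels S) (MonoidHom.ext fun h => ?_)
      rw [MonoidHom.comp_apply, MonoidHom.comp_apply, MonoidHom.comp_apply, MonoidHom.id_apply,
        QuotientGroup.mk'_apply, psiLift, QuotientGroup.lift_mk]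
      change phiHom 𝒯 hrels S hS (PresentedGroup.mk _ (pathWord act (h : FreeGroup X) a₀)) = _
      rw [phiHom_mk]
      have hh : gammaStab 𝒯 S hS (pathWord act (h : FreeGroup X) a₀) = h := by
        apply Subtype.ext
        rw [coe_gammaStab, gammaHom_pathWord, 𝒯.t_root, inv_one, one_mul, map_inv,
          Equiv.Perm.inv_eq_iff_eq.2 ((hS h).1 h.2).symm, 𝒯.t_root, mul_one]
      rw [hh]; rfl)
    (by
      refine PresentedGroup.ext fun e => ?_
      rw [MonoidHom.comp_apply, MonoidHom.id_apply, phiHom_of, psiLift, QuotientGroup.mk'_apply,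
        QuotientGroup.lift_mk]
      have hg : ((gammaStab 𝒯 S hS (FreeGroup.of e) : S) : FreeGroup X) =
          (𝒯.t (act (FreeGroup.of e.1) e.2))⁻¹ * FreeGroup.of e.1 * 𝒯.t e.2 := by
        rw [coe_gammaStab, gammaHom_of]
      show PresentedGroup.mk _ (pathWord act ((gammaStab 𝒯 S hS (FreeGroup.of e) : S) : FreeGroup X) a₀) = _
      have h1 := mk_pathWord_t 𝒯 (rels := rels) (act (FreeGroup.of e.1) e.2)
      have h2 := mk_pathWord_t 𝒯 (rels := rels) e.2
      rw [hg, pathWord_mul_mul, pathWord_inv, map_inv act, map_inv act, inv_inv, 𝒯.t_apply, map_mul,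
        map_mul, map_inv, h1, inv_one, one_mul, pathWord_of, map_inv act, perm_inv_apply_self,
        h2, mul_one]
      rfl)

end Main

/-! ### The case of a subgroup of a presented group -/

/-- The action of `F(X)` on the cosets `⟨X ∣ rels⟩ ⧸ K`. [cite: ZieschangVogtColdewey1980, 2.2.1] -/
noncomputable def cosetAct (rels : Set (FreeGroup X)) (K : Subgroup (PresentedGroup rels)) :
    FreeGroup X →* Equiv.Perm (PresentedGroup rels ⧸ K) :=
  (MulAction.toPermHom (PresentedGroup rels) (PresentedGroup rels ⧸ K)).comp (PresentedGroup.mk rels)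

/-- `cosetAct` is the coset action of the image. [cite: ZieschangVogtColdewey1980, 2.2.1] -/
@[simp] theorem cosetAct_apply (rels : Set (FreeGroup X)) (K : Subgroup (PresentedGroup rels))
    (f : FreeGroup X) (c : PresentedGroup rels ⧸ K) :
    cosetAct rels K f c = PresentedGroup.mk rels f • c := rfl

/-- Relators act trivially on cosets. [cite: ZieschangVogtColdewey1980, 2.2.1] -/
theorem cosetAct_rel {rels : Set (FreeGroup X)} (K : Subgroup (PresentedGroup rels))
    {r : FreeGroup X} (hr : r ∈ rels) : cosetAct rels K r = 1 := by
  ext c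
  rw [cosetAct_apply, (PresentedGroup.mk_eq_one_iff).2 (Subgroup.subset_normalClosure hr), one_smul,
    Equiv.Perm.one_apply]

/-- The stabiliser of the base coset is `K̃`. [cite: ZieschangVogtColdewey1980, 2.2.1] -/
theorem mem_preimage_iff_cosetAct {rels : Set (FreeGroup X)} (K : Subgroup (PresentedGroup rels))
    (f : FreeGroup X) :
    f ∈ PresentedGroup.preimage rels K ↔
      cosetAct rels K f ((1 : PresentedGroup rels) : PresentedGroup rels ⧸ K) = (1 : PresentedGroup rels) := by
  rw [PresentedGroup.mem_preimage, cosetAct_apply, ← MulAction.mem_stabilizer_iff,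
    MulAction.stabilizer_quotient]

/-- **Reidemeister–Schreier by coverings**: a subgroup `K` of `⟨X ∣ rels⟩` is presented on the
edges `X × (G ⧸ K)` of its coset graph by the lifted relators and the edges of any Schreier tree:
`K ≃* ⟨X × (G ⧸ K) ∣ pathWord r b (r ∈ rels, b a coset), tree edges⟩`.
[cite: ZieschangVogtColdewey1980, 2.2.4] -/
noncomputable def subgroupEquivCoveringPresentation {rels : Set (FreeGroup X)}
    (K : Subgroup (PresentedGroup rels))
    (𝒯 : SchreierTree (cosetAct rels K) ((1 : PresentedGroup rels) : PresentedGroup rels ⧸ K)) :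
    K ≃* PresentedGroup (liftedRels (cosetAct rels K) rels 𝒯.edges) :=
  (PresentedGroup.subgroupEquivQuotientPreimage rels K).trans
    (stabilizerQuotientEquiv 𝒯 (fun _ hr => cosetAct_rel K hr) (PresentedGroup.preimage rels K)
      (mem_preimage_iff_cosetAct K))

end CoveringPresentation

end Literature.GroupTheory.CombinatorialGroupTheory
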